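/-
Copyright (c) 2026. All rights reserved.
Released under Apache 2.0 license as described in the file LICENSE.
Authors: abc-iut cell, seat abc-iut-L4-t14 (gen 3; topology brick: the maps `[x] ↦ [g • x]` between
orbit spaces `M/K → M/L` for `gKg⁻¹ ≤ L` are covering maps, with finite fibres when `[L : gKg⁻¹] < ∞`).
-/
import Literature.Geometry.Manifold.QuotientSubgroupCovering
import HarnessLib

/-!
# The maps `[x]_K ↦ [g • x]_L : M/K → M/L` (`g K g⁻¹ ≤ L`) are covering maps

A. Hatcher, *Algebraic Topology* (CUP 2002), §1.3 Exercise 24 ("each subgroup `H ⊂ G` determines a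
composition of covering spaces `X → X/H → X/G`"); the twist by an ambient group element `g` (for the
abc-iut cell: the maps `z ↦ g z : ℍ/Λ₁ → ℍ/Λ₂`, `g ∈ PSL₂(ℝ)`, `gΛ₁g⁻¹ ≤ Λ₂`, of S. Mochizuki,
*Topics in absolute anabelian geometry III*, proof of Prop 4.2 (i) p. 106, category `Loc_R(X)`).

Let a group `N` act by homeomorphisms on a locally compact Hausdorff space `M`, and let `K, L ≤ N` be
subgroups, `L` acting freely and properly discontinuously.  For `g ∈ N` with `g K g⁻¹ ≤ L`:

* `QuotientManifold.quotientMap g K L h : M/K → M/L`, `[x] ↦ [g • x]` (any action; `quotientMap_mk`,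
  `quotientMap_comp`, `quotientMap_eq_of_mul_mem`, `continuous_quotientMap`);
* `QuotientManifold.exists_homeomorph_quotientMap_conj` — `[x] ↦ [g • x]` is a homeomorphism
  `M/K ≃ₜ M/(gKg⁻¹)` (`conjSubgroup g K = gKg⁻¹`);
* `QuotientManifold.exists_homeomorph_subgroupOf` — `M/(K viewed in L) ≃ₜ M/K` by the identity on
  representatives (for `K ≤ L`), matching `toQuotient (K.subgroupOf L)` with `quotientMap 1 K L`;
* **`QuotientManifold.isCoveringMap_quotientMap`** — `quotientMap g K L` is a COVERING MAP (the
  previous file's `isCoveringMap_toQuotient_subgroup` transported along the two homeomorphisms);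
  `QuotientManifold.finite_preimage_quotientMap` — its fibres are finite when `[L : gKg⁻¹] < ∞`.

Proof-only apart from the two small definitions `quotientMap`, `conjSubgroup`; classical topology.
-/

set_option autoImplicit false

open _root_.MulAction _root_.Function _root_.Set _root_.Topology

namespace Literature.Geometry.Manifold

namespace QuotientManifold

universe u

/-! ### The maps `[x] ↦ [g • x]` between orbit spaces (any action) -/

section QuotientMap

variable {N : Type u} [Group N] {T : Type*} [MulAction N T]

/-- **`[x]_K ↦ [g • x]_L`** for `g ∈ N` with `g K g⁻¹ ≤ L` (well defined: `g • (k • x) = (g k g⁻¹) • (g • x)`).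
[cite: HatcherAT2002, §1.3 Exercise 24] -/
def quotientMap (g : N) (K L : Subgroup N) (h : ∀ x ∈ K, g * x * g⁻¹ ∈ L) :
    orbitRel.Quotient K T → orbitRel.Quotient L T :=
  Quotient.map' (fun x : T => g • x) fun a b hab => by
    obtain ⟨k, rfl⟩ := hab
    refine ⟨⟨g * (k : N) * g⁻¹, h _ k.2⟩, ?_⟩
    change (g * (k : N) * g⁻¹) • g • b = g • ((k : N) • b)
    rw [smul_smul, smul_smul, inv_mul_cancel_right]

/-- `quotientMap` on classes. [cite: HatcherAT2002, §1.3 Exercise 24] -/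
@[simp] theorem quotientMap_mk (g : N) (K L : Subgroup N) (h : ∀ x ∈ K, g * x * g⁻¹ ∈ L) (x : T) :
    quotientMap g K L h (Quotient.mk _ x) = Quotient.mk _ (g • x) := rfl

/-- Composition: `quotientMap g' ∘ quotientMap g = quotientMap (g' g)`.
[cite: HatcherAT2002, §1.3 Exercise 24] -/
theorem quotientMap_comp (g g' : N) (K L P : Subgroup N) (h : ∀ x ∈ K, g * x * g⁻¹ ∈ L)
    (h' : ∀ x ∈ L, g' * x * g'⁻¹ ∈ P) (h'' : ∀ x ∈ K, g' * g * x * (g' * g)⁻¹ ∈ P) :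
    quotientMap (T := T) g' L P h' ∘ quotientMap g K L h = quotientMap (g' * g) K P h'' := by
  funext q
  induction q using Quotient.inductionOn with
  | h x => simp [smul_smul]

/-- Changing the representative by an element of `L` does not change the map.
[cite: HatcherAT2002, §1.3 Exercise 24] -/
theorem quotientMap_eq_of_mul_mem (g g' : N) (K L : Subgroup N) (h : ∀ x ∈ K, g * x * g⁻¹ ∈ L)
    (h' : ∀ x ∈ K, g' * x * g'⁻¹ ∈ L) (hgg' : g' * g⁻¹ ∈ L) :
    quotientMap (T := T) g K L h = quotientMap g' K L h' := by
  funext q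
  induction q using Quotient.inductionOn with
  | h x =>
    rw [quotientMap_mk, quotientMap_mk]
    refine Quotient.sound ⟨⟨g' * g⁻¹, hgg'⟩⁻¹, ?_⟩
    change (g' * g⁻¹)⁻¹ • g' • x = g • x
    rw [smul_smul, mul_inv_rev, inv_inv, inv_mul_cancel_right]

variable [TopologicalSpace T] [ContinuousConstSMul N T]

/-- `quotientMap` is continuous. [cite: HatcherAT2002, §1.3 Exercise 24] -/
theorem continuous_quotientMap (g : N) (K L : Subgroup N) (h : ∀ x ∈ K, g * x * g⁻¹ ∈ L) :
    Continuous (quotientMap (T := T) g K L h) :=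
  (continuous_const_smul g).quotient_map' _

/-- The conjugate subgroup `g K g⁻¹`. [cite: HatcherAT2002, §1.3 Exercise 24] -/
abbrev conjSubgroup (g : N) (K : Subgroup N) : Subgroup N := K.map (MulAut.conj g).toMonoidHom

/-- `x ∈ K ⟹ g x g⁻¹ ∈ g K g⁻¹`. [cite: HatcherAT2002, §1.3 Exercise 24] -/
theorem conj_mem_conjSubgroup (g : N) (K : Subgroup N) :
    ∀ x ∈ K, g * x * g⁻¹ ∈ conjSubgroup g K := fun x hx =>
  ⟨x, hx, rfl⟩

/-- `y ∈ g K g⁻¹ ⟹ g⁻¹ y g ∈ K`. [cite: HatcherAT2002, §1.3 Exercise 24] -/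
theorem inv_conj_mem_of_mem_conjSubgroup (g : N) (K : Subgroup N) :
    ∀ y ∈ conjSubgroup g K, g⁻¹ * y * g⁻¹⁻¹ ∈ K := by
  rintro _ ⟨x, hx, rfl⟩
  change g⁻¹ * (g * x * g⁻¹) * g⁻¹⁻¹ ∈ K
  simpa [mul_assoc] using hx

/-- **The conjugation homeomorphism `X̃/K ≃ₜ X̃/(gKg⁻¹)`**, `[x] ↦ [g • x]`, inverse `[y] ↦ [g⁻¹ • y]`.
Stated as an existence (no packaging def). [cite: HatcherAT2002, §1.3 Exercise 24] -/
theorem exists_homeomorph_quotientMap_conj (g : N) (K : Subgroup N) :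
    ∃ e : orbitRel.Quotient K T ≃ₜ orbitRel.Quotient (conjSubgroup g K) T,
      ⇑e = quotientMap g K (conjSubgroup g K) (conj_mem_conjSubgroup g K) := by
  refine ⟨{ toFun := quotientMap g K (conjSubgroup g K) (conj_mem_conjSubgroup g K)
            invFun := quotientMap g⁻¹ (conjSubgroup g K) K (inv_conj_mem_of_mem_conjSubgroup g K)
            left_inv := ?_
            right_inv := ?_
            continuous_toFun := continuous_quotientMap _ _ _ _
            continuous_invFun := continuous_quotientMap _ _ _ _ }, rfl⟩
  · intro q
    induction q using Quotient.inductionOn with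
    | h x => simp [smul_smul]
  · intro q
    induction q using Quotient.inductionOn with
    | h x => simp [smul_smul]

end QuotientMap

/-! ### Covering property: `X̃/K → X̃/L` for `gKg⁻¹ ≤ L`, `L` acting freely, properly discontinuously -/

section Covering

variable {N : Type u} [Group N] {T : Type*} [TopologicalSpace T] [MulAction N T]
  [ContinuousConstSMul N T] [T2Space T] [LocallyCompactSpace T]

omit [ContinuousConstSMul N T] [T2Space T] [LocallyCompactSpace T] in
/-- The quotient by `K ≤ L` viewed as a subgroup of `L` is homeomorphic (by the identity on
representatives) to the quotient by `K`; under it `QuotientManifold.toQuotient (K.subgroupOf L)` becomes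
`quotientMap 1 K L`. Existence form. [cite: HatcherAT2002, §1.3 Exercise 24] -/
theorem exists_homeomorph_subgroupOf (K L : Subgroup N) (hKL : K ≤ L) :
    ∃ e : orbitRel.Quotient (K.subgroupOf L) T ≃ₜ orbitRel.Quotient K T,
      ∀ x : T, e (Quotient.mk _ x) = Quotient.mk _ x := by
  have hrel : ∀ a b : T, orbitRel (K.subgroupOf L) T a b ↔ orbitRel K T a b := by
    intro a b
    constructor
    · rintro ⟨k, rfl⟩
      exact ⟨⟨((k : L) : N), Subgroup.mem_subgroupOf.mp k.2⟩, rfl⟩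
    · rintro ⟨k, rfl⟩
      exact ⟨⟨⟨(k : N), hKL k.2⟩, Subgroup.mem_subgroupOf.mpr k.2⟩, rfl⟩
  refine ⟨{ toFun := Quotient.map' id fun a b hab => (hrel a b).mp hab
            invFun := Quotient.map' id fun a b hab => (hrel a b).mpr hab
            left_inv := fun q => Quotient.inductionOn q fun _ => rfl
            right_inv := fun q => Quotient.inductionOn q fun _ => rfl
            continuous_toFun := continuous_id.quotient_map' _
            continuous_invFun := continuous_id.quotient_map' _ }, fun _ => rfl⟩

/-- **`quotientMap 1 K L : X̃/K → X̃/L` is a covering map** for `K ≤ L`, `L` acting freely and properly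
discontinuously on a locally compact Hausdorff space (Hatcher §1.3 Ex. 24 via the tree's
`QuotientManifold.isCoveringMap_toQuotient_subgroup`). [cite: HatcherAT2002, §1.3 Exercise 24] -/
theorem isCoveringMap_quotientMap_one (K L : Subgroup N) (hKL : K ≤ L)
    [ProperlyDiscontinuousSMul L T] [IsCancelSMul L T] :
    IsCoveringMap (quotientMap (T := T) 1 K L (fun x hx => by simpa using hKL hx)) := by
  obtain ⟨e, he⟩ := exists_homeomorph_subgroupOf (T := T) K L hKL
  have hcomp : QuotientManifold.toQuotient (K.subgroupOf L) ∘ e.symm =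
      quotientMap (T := T) 1 K L (fun x hx => by simpa using hKL hx) := by
    funext q
    induction q using Quotient.inductionOn with
    | h x =>
      have hx : e.symm (Quotient.mk _ x) = Quotient.mk _ x := by
        rw [Homeomorph.symm_apply_eq, he]
      simp only [Function.comp_apply, hx, quotientMap_mk, one_smul]
      rfl
  rw [← hcomp]
  exact (QuotientManifold.isCoveringMap_toQuotient_subgroup (K.subgroupOf L)).comp_homeomorph e.symm

omit [ContinuousConstSMul N T] [T2Space T] [LocallyCompactSpace T] in
/-- The fibres of `quotientMap 1 K L` are finite when `[L : K] < ∞`. [cite: HatcherAT2002, §1.3 Exercise 24] -/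
theorem finite_preimage_quotientMap_one (K L : Subgroup N) (hKL : K ≤ L)
    [(K.subgroupOf L).FiniteIndex] (q : orbitRel.Quotient L T) :
    (quotientMap (T := T) 1 K L (fun x hx => by simpa using hKL hx) ⁻¹' {q}).Finite := by
  obtain ⟨e, he⟩ := exists_homeomorph_subgroupOf (T := T) K L hKL
  have hcomp : quotientMap (T := T) 1 K L (fun x hx => by simpa using hKL hx) =
      QuotientManifold.toQuotient (K.subgroupOf L) ∘ e.symm := by
    funext q
    induction q using Quotient.inductionOn with
    | h x =>
      have hx : e.symm (Quotient.mk _ x) = Quotient.mk _ x := by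
        rw [Homeomorph.symm_apply_eq, he]
      simp only [Function.comp_apply, hx, quotientMap_mk, one_smul]
      rfl
  rw [hcomp, Set.preimage_comp]
  exact (QuotientManifold.finite_preimage_toQuotient_singleton (K.subgroupOf L) q).preimage
    e.symm.injective.injOn

/-- **`quotientMap g K L : X̃/K → X̃/L` is a covering map** whenever `g K g⁻¹ ≤ L`: conjugation
homeomorphism `X̃/K ≃ₜ X̃/gKg⁻¹` followed by the intermediate quotient `X̃/gKg⁻¹ → X̃/L`.
[cite: HatcherAT2002, §1.3 Exercise 24] -/
theorem isCoveringMap_quotientMap (g : N) (K L : Subgroup N) (h : ∀ x ∈ K, g * x * g⁻¹ ∈ L)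
    [ProperlyDiscontinuousSMul L T] [IsCancelSMul L T] :
    IsCoveringMap (quotientMap (T := T) g K L h) := by
  have hle : conjSubgroup g K ≤ L := by
    rintro _ ⟨x, hx, rfl⟩
    exact h x hx
  obtain ⟨e, he⟩ := exists_homeomorph_quotientMap_conj (T := T) g K
  have hcomp : quotientMap (T := T) 1 (conjSubgroup g K) L (fun x hx => by simpa using hle hx) ∘ e =
      quotientMap g K L h := by
    rw [he, quotientMap_comp]
    · funext q
      induction q using Quotient.inductionOn with
      | h x => simp
    · intro x hx
      simpa using h x hx
  rw [← hcomp]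
  exact (isCoveringMap_quotientMap_one (conjSubgroup g K) L hle).comp_homeomorph e

omit [T2Space T] [LocallyCompactSpace T] in
/-- **Finite fibres**: if `[L : gKg⁻¹] < ∞` then `quotientMap g K L` has finite fibres.
[cite: HatcherAT2002, §1.3 Exercise 24] -/
theorem finite_preimage_quotientMap (g : N) (K L : Subgroup N) (h : ∀ x ∈ K, g * x * g⁻¹ ∈ L)
    [((conjSubgroup g K).subgroupOf L).FiniteIndex] (q : orbitRel.Quotient L T) :
    (quotientMap (T := T) g K L h ⁻¹' {q}).Finite := by
  have hle : conjSubgroup g K ≤ L := by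
    rintro _ ⟨x, hx, rfl⟩
    exact h x hx
  obtain ⟨e, he⟩ := exists_homeomorph_quotientMap_conj (T := T) g K
  have hcomp : quotientMap g K L h =
      quotientMap (T := T) 1 (conjSubgroup g K) L (fun x hx => by simpa using hle hx) ∘ e := by
    rw [he, quotientMap_comp]
    · funext q
      induction q using Quotient.inductionOn with
      | h x => simp
    · intro x hx
      simpa using h x hx
  rw [hcomp, Set.preimage_comp]
  exact (finite_preimage_quotientMap_one (conjSubgroup g K) L hle q).preimage e.injective.injOn

end Covering


end QuotientManifold

end Literature.Geometry.Manifold
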